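import Summits.AnomalousDissipation.AnomalousDissipation.Theorems.BaireTransferRobustLoudUpgradeStubSteadyStratumClosed

/-!
# Stub `stub_steadyCorrespondenceUhc` of the line `malkin-cone-group-orbits`
# (crux stmt-AnomalousDissipation-1144, lead c15, wave 2):
# the steady correspondence of a stratum is upper hemicontinuous

For a stratum index `n` the steady correspondence
`Φₙ(c) = {(ν, U) : ν ∈ [1/(n+1), n], ‖∇U‖² ≤ n², U ∈ H a steady weak solution of NS_ν(f_c)}`
(values in `ℝ × H`) is UPPER HEMICONTINUOUS in the coefficient vector `c ∈ P_S`.  Proof: all values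
lie in the fixed compact set `K = [1/(n+1), n] × {‖∇U‖² ≤ n²}` (Rellich,
`isCompact_setOf_eGradNormSq_le`), so by the sequential criterion
`UpperHemicontinuousAt.of_sequences` it suffices to check that the graph is closed along sequences:
if `c_m → c`, `(ν_m, U_m) ∈ Φₙ(c_m)` and `(ν_m, U_m) → (ν, U)`, then `(ν, U) ∈ K` (closed) and `U` is
a steady weak solution of `NS_ν(f_c)` — the tested generator is affine in `ν`, continuous in `U`
(`continuous_nsGeneratorPairing`) and in the force (`Negative.continuous_pairing`), exactly the
varying-viscosity limit of `stub_steadyStratumClosed`.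
-/

-- `Summit.<Summit>.<Problem>` is the tree's mandated summit-side namespace (CONVENTIONS §2); for this
-- single-conjunct summit the two coincide, so the duplicate is deliberate.
set_option linter.dupNamespace false

noncomputable section

open scoped BigOperators Topology InnerProductSpace RealInnerProductSpace ENNReal
open Filter Set Function TopologicalSpace MeasureTheory

namespace Summit.AnomalousDissipation.AnomalousDissipation.Theorems.RobustLoudUpgrade.Category

open Literature.Analysis.FunctionSpaces Literature.Analysis.FunctionSpaces.Torus
open Literature.Analysis.FluidPDE Literature.Analysis.FluidPDE.Torus
open Summit.AnomalousDissipation.AnomalousDissipation.Theses.BaireTransfer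
open Summit.AnomalousDissipation.AnomalousDissipation.Theorems.DenseLoudDesignerForces
open Summit.AnomalousDissipation.AnomalousDissipation.Theorems.RobustLoudUpgrade.CensusInterior

/-! ## §1 Closed graph of the steady weak formulation under `(c, ν, U) → (c₀, ν₀, U₀)` -/

/-- **Closed graph with varying force and viscosity.**  If `c_m → c` in `P_S`, `ν_m → ν`, `U_m → U`
in `H`, and each `U_m` is a steady weak solution of `NS_{ν_m}(f_{c_m})`, then `U` is a steady weak
solution of `NS_ν(f_c)`: for a fixed test field `w ∈ 𝒱` the tested generator
`⟨F_{ν,c}(U_m), w⟩ = ((f_c, w) − (f_{c_m}, w)) + (ν − ν_m)(U_m, Δw)` (affine in `ν`), whose right side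
tends to `0` and whose left side tends to `⟨F_{ν,c}(U), w⟩`. [folklore] -/
theorem isSteadyWeakSolution_of_tendsto {S : Finset (Fin 3 → ℤ)} {x : ℕ → Coeff S} {c : Coeff S}
    (hxc : Tendsto x atTop (𝓝 c)) {nu : ℕ → ℝ} {ν : ℝ} (hν : Tendsto nu atTop (𝓝 ν))
    {U : ℕ → energySpace (Fin 3)} {Ul : energySpace (Fin 3)} (hU : Tendsto U atTop (𝓝 Ul))
    (hUw : ∀ m, IsSteadyWeakSolution (nu m) (force S (x m)) (U m)) :
    IsSteadyWeakSolution ν (force S c) Ul := by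
  intro w hw hwd hwm
  -- `P W = (W, Δw)` on representatives
  set P : energySpace (Fin 3) → ℝ := fun W =>
    ∫ y, ⟪(W.1 : UnitAddTorus (Fin 3) → EuclideanSpace ℝ (Fin 3)) y, laplacian w y⟫_ℝ with hPdef
  have hA : Tendsto (fun m => nsGeneratorPairing ν (force S c) (U m) w) atTop
      (𝓝 (nsGeneratorPairing ν (force S c) Ul w)) :=
    ((continuous_nsGeneratorPairing ν (force S c) hw).tendsto Ul).comp hU
  have hB : ∀ m, nsGeneratorPairing ν (force S c) (U m) w =
      ((∫ y, ⟪force S c y, w y⟫_ℝ) - ∫ y, ⟪force S (x m) y, w y⟫_ℝ) +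
        (ν - nu m) * P (U m) := fun m => by
    have h := hUw m w hw hwd hwm
    unfold nsGeneratorPairing at h ⊢
    rw [hPdef]
    linear_combination h
  have hPc : Continuous fun c' : Coeff S => ∫ y, ⟪force S c' y, w y⟫_ℝ :=
    Negative.continuous_pairing S hw.continuous
  have hC₁ : Tendsto (fun m => (∫ y, ⟪force S c y, w y⟫_ℝ) - ∫ y, ⟪force S (x m) y, w y⟫_ℝ)
      atTop (𝓝 0) := by
    have h : Tendsto (fun m => (∫ y, ⟪force S c y, w y⟫_ℝ) - ∫ y, ⟪force S (x m) y, w y⟫_ℝ)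
        atTop (𝓝 ((∫ y, ⟪force S c y, w y⟫_ℝ) - ∫ y, ⟪force S c y, w y⟫_ℝ)) :=
      tendsto_const_nhds.sub ((hPc.tendsto c).comp hxc)
    rw [sub_self] at h
    exact h
  have hP : Tendsto (fun m => P (U m)) atTop (𝓝 (pairing Ul.1 (laplacian w))) :=
    ((continuous_pairing_coe (hw.laplacian.memLp 2)).tendsto Ul).comp hU
  have hC₂ : Tendsto (fun m => (ν - nu m) * P (U m)) atTop (𝓝 0) := by
    have h : Tendsto (fun m => (ν - nu m) * P (U m)) atTop
        (𝓝 ((ν - ν) * pairing Ul.1 (laplacian w))) :=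
      (tendsto_const_nhds.sub hν).mul hP
    rw [sub_self, zero_mul] at h
    exact h
  have hC := hC₁.add hC₂
  rw [add_zero] at hC
  exact tendsto_nhds_unique hA (hC.congr fun m => (hB m).symm)

/-! ## §2 The stub -/

/-- **stub_steadyCorrespondenceUhc** (registered sub-goal, c15 wave 2).  The steady correspondence of
the stratum `n` — pairs `(ν, U)` with `ν ∈ [1/(n+1), n]`, `‖∇U‖² ≤ n²` and `U ∈ H` a steady weak
solution of `NS_ν(f_c)` — is UPPER HEMICONTINUOUS in `c` (closed graph by the varying-viscosity
limit `isSteadyWeakSolution_of_tendsto`, values in the fixed compact set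
`[1/(n+1), n] × {‖∇U‖² ≤ n²}`; sequences suffice in the metric space `P_S`,
`UpperHemicontinuousAt.of_sequences`). [folklore] -/
theorem stub_steadyCorrespondenceUhc : ∀ (S : Finset (Fin 3 → ℤ)) (n : ℕ),
    UpperHemicontinuous (fun c : Coeff S =>
      {q : ℝ × energySpace (Fin 3) | 1 / ((n : ℝ) + 1) ≤ q.1 ∧ q.1 ≤ (n : ℝ) ∧
        eGradNormSq (q.2.1 : UnitAddTorus (Fin 3) → EuclideanSpace ℝ (Fin 3)) ≤ ENNReal.ofReal ((n : ℝ) ^ 2) ∧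
          Torus.IsSteadyWeakSolution q.1 (force S c) q.2}) := by
  intro S n
  -- the fixed compact (hence closed) set of values: viscosity slab × enstrophy ball (Rellich)
  set K : Set (ℝ × energySpace (Fin 3)) := Icc (1 / ((n : ℝ) + 1)) (n : ℝ) ×ˢ
    {W : energySpace (Fin 3) | eGradNormSq (W.1 : UnitAddTorus (Fin 3) → EuclideanSpace ℝ (Fin 3)) ≤
      ENNReal.ofReal ((n : ℝ) ^ 2)} with hKdef
  have hKc : IsCompact K :=
    isCompact_Icc.prod (isCompact_setOf_eGradNormSq_le ENNReal.ofReal_ne_top)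
  have hKcl : IsClosed K := isClosed_Icc.prod (isClosed_setOf_eGradNormSq_le _)
  refine upperHemicontinuous_iff.2 fun c => ?_
  refine UpperHemicontinuousAt.of_sequences hKc.isSeqCompact
    (Eventually.of_forall fun c' q hq => ⟨⟨hq.1, hq.2.1⟩, hq.2.2.1⟩) ?_
  intro x hxc q hq q₀ hq₀
  -- the limit lies in the closed set `K` ...
  have hK₀ : q₀ ∈ K :=
    hKcl.mem_of_tendsto hq₀ (Eventually.of_forall fun m => ⟨⟨(hq m).1, (hq m).2.1⟩, (hq m).2.2.1⟩)
  -- ... and is a steady weak solution of `NS_{ν₀}(f_c)` by the closed-graph lemma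
  exact ⟨hK₀.1.1, hK₀.1.2, hK₀.2, isSteadyWeakSolution_of_tendsto hxc
    ((continuous_fst.tendsto _).comp hq₀) ((continuous_snd.tendsto _).comp hq₀) fun m => (hq m).2.2.2⟩

end Summit.AnomalousDissipation.AnomalousDissipation.Theorems.RobustLoudUpgrade.Category

end
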